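import Mathlib

/-!
# The shadow wall: in the σ = 1 shadow the `|Z|` targets are free
# (crux `LevelGradedCohnUmans.GradedDesignFamily`, stmt-MatrixMultiplication-7610; negative side,
# line `quadratic-extension-level-one-cell`, lead c7)

Let `H ≤ G` be a subgroup of a finite group, `J' ≤ ℂ^G` ANY subspace, `Y, Z ⊆ G` finite sets with
`Y ≠ ∅`, and suppose every target `z₀ ∈ Z` has a LEFT-`H`-INVARIANT separator `F ∈ J'` with
`F(y y'⁻¹ z) = [y = y' ∧ z = z₀]` on `Y × Y × Z` — the conclusion of `shadow_separator`
(`Negative/Shadow.lean`, the σ = 1 shadow of one-subgroup separation) for an abstract subspace `J'`.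
Then for every finite set `S` of left-`H`-saturated GARBAGE words `h · (y y'⁻¹ z)`
(`h ∈ H`, `y, y' ∈ Y`, `z ∈ Z`, `y ≠ y'`),

* `shadow_wall` — `|Z| + dim (J'|_S) ≤ dim J'`,

where `J'|_S = J'.map (funLeft (↑))` is the space of restrictions to `S` of functions in `J'`.
This is the matroid / coloop form of the shadow design problem: the garbage cosets must have corank
`≥ |Z|` in the invariant test space, however large the garbage set is.

PROOF (the proof of `card_mul_card_add_finrank_restrict_le` of `Negative/GarbageWall.lean` with
`X = {1}`).  Pick `y₁ ∈ Y` and separators `f_z ∈ J'` (`z ∈ Z`).  Evaluation at the `|Z|` words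
`y₁ y₁⁻¹ z`, `Φ₁ f := (f(y₁ y₁⁻¹ z))_{z ∈ Z}`, maps `J'` ONTO `ℂ^Z` (`Φ₁ f_{z₀}` is the coordinate
vector of `z₀`), so `dim J' = |Z| + dim ker Φ₁`; and restriction to `S`, `Φ₂`, kills every
separator (`f_{z₀}(h · y y'⁻¹ z) = f_{z₀}(y y'⁻¹ z) = 0` by `H`-invariance and `y ≠ y'`), hence
`Φ₂ f = Φ₂ (f − Σ_z Φ₁(f)_z · f_z)` with `f − Σ_z Φ₁(f)_z f_z ∈ ker Φ₁`:
`J'|_S = Φ₂(ker Φ₁)` has dimension `≤ dim ker Φ₁`.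

Sorry-free; axioms `propext`, `Classical.choice`, `Quot.sound`.
-/

set_option linter.dupNamespace false

noncomputable section

open scoped BigOperators
open Module

namespace Summit.MatrixMultiplication.MatrixMultiplication.Theorems.GradedDesignFamily.Negative

/-- **The shadow wall.**  If every target `z₀ ∈ Z` has a left-`H`-invariant separator `F ∈ J'`
with `F(y y'⁻¹ z) = [y = y' ∧ z = z₀]` on `Y × Y × Z` (`Y ≠ ∅`), and `S` is a finite set of
left-`H`-saturated garbage words `h · (y y'⁻¹ z)` with `h ∈ H`, `y ≠ y'`, then
`|Z| + dim J'|_S ≤ dim J'`. -/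
theorem shadow_wall {G : Type} [Group G] [Fintype G] [DecidableEq G] (H : Subgroup G)
    (J' : Submodule ℂ (G → ℂ)) (Y Z : Finset G) (hY : Y.Nonempty)
    (hsh : ∀ z₀ ∈ Z, ∃ F ∈ J', (∀ h : G, h ∈ H → ∀ g : G, F (h * g) = F g) ∧
      ∀ y ∈ Y, ∀ y' ∈ Y, ∀ z ∈ Z, F (y * y'⁻¹ * z) = if (y = y' ∧ z = z₀) then 1 else 0)
    (S : Finset G)
    (hS : ∀ s ∈ S, ∃ h : G, h ∈ H ∧ ∃ y ∈ Y, ∃ y' ∈ Y, ∃ z ∈ Z, y ≠ y' ∧ s = h * (y * y'⁻¹ * z)) :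
    Z.card + Module.finrank ℂ (J'.map (LinearMap.funLeft ℂ ℂ ((↑) : ↥S → G))) ≤
      Module.finrank ℂ J' := by
  classical
  obtain ⟨y₁, hy₁⟩ := hY
  -- separators, one per target
  let R : Type := ↥Z
  have hrow : ∀ r : R, ∃ f : J',
      (∀ h : G, h ∈ H → ∀ g : G, (f : G → ℂ) (h * g) = (f : G → ℂ) g) ∧
      ∀ y ∈ Y, ∀ y' ∈ Y, ∀ z ∈ Z,
        (f : G → ℂ) (y * y'⁻¹ * z) = if (y = y' ∧ z = (r : G)) then 1 else 0 := by
    intro r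
    obtain ⟨F, hFJ, hinv, hval⟩ := hsh (r : G) r.2
    exact ⟨⟨F, hFJ⟩, hinv, hval⟩
  choose f hfinv hf using hrow
  -- Φ₁ : evaluation at the target words (through `y₁ y₁⁻¹`)
  let Φ₁ : J' →ₗ[ℂ] (R → ℂ) := LinearMap.pi fun r : R =>
    (LinearMap.proj (y₁ * y₁⁻¹ * (r : G)) : (G → ℂ) →ₗ[ℂ] ℂ).comp J'.subtype
  have hΦ₁ : ∀ (φ : J') (r : R), Φ₁ φ r = (φ : G → ℂ) (y₁ * y₁⁻¹ * (r : G)) :=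
    fun φ r => rfl
  have hΦ₁f : ∀ r₀ r : R, Φ₁ (f r₀) r = if r = r₀ then 1 else 0 := by
    intro r₀ r
    rw [hΦ₁, hf r₀ y₁ hy₁ y₁ hy₁ _ r.2]
    by_cases hrr : r = r₀
    · subst hrr; simp
    · rw [if_neg hrr, if_neg]
      rintro ⟨-, hz⟩
      exact hrr (Subtype.ext hz)
  have hsurj : Function.Surjective Φ₁ := by
    intro w
    refine ⟨∑ r, w r • f r, ?_⟩
    rw [map_sum]
    funext r₀
    simp only [map_smul, Finset.sum_apply, Pi.smul_apply, hΦ₁f, smul_eq_mul, mul_ite, mul_one,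
      mul_zero]
    rw [Finset.sum_ite_eq]
    simp
  -- Φ₂ : restriction to the garbage set `S`; it kills every separator
  let Φ₂ : J' →ₗ[ℂ] (↥S → ℂ) := (LinearMap.funLeft ℂ ℂ ((↑) : ↥S → G)).comp J'.subtype
  have hΦ₂ : ∀ (φ : J') (s : ↥S), Φ₂ φ s = (φ : G → ℂ) s := fun φ s => rfl
  have hΦ₂f : ∀ r : R, Φ₂ (f r) = 0 := by
    intro r
    funext s
    obtain ⟨h, hh, y, hy, y', hy', z, hz, hne, hs⟩ := hS s s.2
    rw [hΦ₂, Pi.zero_apply, hs, hfinv r h hh, hf r y hy y' hy' z hz, if_neg]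
    rintro ⟨hyy, -⟩
    exact hne hyy
  -- range Φ₂ = Φ₂ (ker Φ₁)
  have hrange : LinearMap.range Φ₂ ≤ LinearMap.range (Φ₂.comp (LinearMap.ker Φ₁).subtype) := by
    rintro _ ⟨φ, rfl⟩
    have hker : φ - ∑ r, Φ₁ φ r • f r ∈ LinearMap.ker Φ₁ := by
      rw [LinearMap.mem_ker, map_sub, map_sum, sub_eq_zero]
      funext r₀
      simp only [map_smul, Finset.sum_apply, Pi.smul_apply, hΦ₁f, smul_eq_mul, mul_ite, mul_one,
        mul_zero]
      rw [Finset.sum_ite_eq]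
      simp
    refine ⟨⟨_, hker⟩, ?_⟩
    rw [LinearMap.comp_apply, Submodule.subtype_apply, map_sub, map_sum]
    simp only [map_smul, hΦ₂f, smul_zero, Finset.sum_const_zero, sub_zero]
  -- bookkeeping
  have hmap : J'.map (LinearMap.funLeft ℂ ℂ ((↑) : ↥S → G)) = LinearMap.range Φ₂ := by
    rw [LinearMap.range_comp, Submodule.range_subtype]
  have h1 : finrank ℂ (LinearMap.range Φ₂) ≤ finrank ℂ (LinearMap.ker Φ₁) :=
    (Submodule.finrank_mono hrange).trans (LinearMap.finrank_range_le _)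
  have hrn := LinearMap.finrank_range_add_finrank_ker Φ₁
  rw [LinearMap.range_eq_top.mpr hsurj, finrank_top, Module.finrank_fintype_fun_eq_card] at hrn
  have hR : Fintype.card R = Z.card := Fintype.card_coe Z
  rw [hmap, ← hrn, ← hR]
  omega

end Summit.MatrixMultiplication.MatrixMultiplication.Theorems.GradedDesignFamily.Negative

end
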